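import Literature.RepresentationTheory.ModularTensorCategories.KLRacahOrthogonality
import Literature.Analysis.SpecialFunctions.QVWPFactorialSum

/-!
# The norm of the extremal column of the Kauffman–Lins Racah matrix

For labels `(a,b,c,d)` at level `k` normalised so that `b ≤ a`, `|c - d| ≤ a - b` and `a + b + c + d ≤ 2k` (every
configuration is brought to this form by the symmetries of the problem, see `KLRacahNormReduce.lean`), the column
`j₀ = a - b` of `S_{ij} = racahSum k a b j c d i` consists of single terms, and
`Σ_{i ∈ I} ṽ_i S_{ij₀}² = 1/v_{j₀}` (`racahSum_norm_small`): after the substitution `i = i_min + 2y` the sum is the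
factorial form of Rogers' very-well-poised `₆φ₅` sum (`vwp_factorial_sum` of
`Analysis/SpecialFunctions/QVWPFactorialSum.lean`) evaluated at `p = e^{iπ/(k+2)}`. This is the one normalised column
needed by the spectral argument `racahSum_gram_of_norm`.
[cite: KauffmanLins1994, §9.11–9.12] [cite: GasperRahman2004, §7.2 eq. (7.2.15)–(7.2.16) (the norm h_n of the q-Racah
polynomials)]
-/

noncomputable section

namespace Literature.RepresentationTheory.ModularTensorCategories.SU2LevelK

open Finset Literature.Analysis.SpecialFunctions

variable (k : ℕ)

/-! ### The factorial-form VWP sum in real quantum integers -/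

/-- The real form of `vwpTerm` at `p = e^{iπ/(k+2)}`:
`[2y+μ+1][y+B]![y+μ]![y+g]![e-y]!/([y+μ+1+n]![y]![y+δ]![n-y]!)`. [cite: GasperRahman2004, §7.2] -/
def vwpTermR (g δ n ε y : ℕ) : ℝ :=
  qInt k (2 * y + (g + δ) + 1) * qFactorial k (y + (g + δ + 1 + (n + ε))) * qFactorial k (y + (g + δ)) *
      qFactorial k (y + g) * qFactorial k (n + ε - y) /
    (qFactorial k (y + (g + δ) + 1 + n) * qFactorial k y * qFactorial k (y + δ) * qFactorial k (n - y))

/-- The real closed form `[B]![g]![e+g+1]![ε]!/([n]![ε+g+1]![δ+n]!)`. [cite: GasperRahman2004, §7.2] -/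
def vwpClosedR (g δ n ε : ℕ) : ℝ :=
  qFactorial k (g + δ + 1 + (n + ε)) * qFactorial k g * qFactorial k (n + ε + g + 1) * qFactorial k ε /
    (qFactorial k n * qFactorial k (ε + g + 1) * qFactorial k (δ + n))

/-- Cast of `vwpTermR` to `ℂ`. [folklore] -/
theorem vwpTermR_cast (g δ n ε y : ℕ) : (vwpTermR k g δ n ε y : ℂ) = vwpTerm (klP k) g δ n ε y := by
  unfold vwpTermR vwpTerm
  push_cast
  rw [← qBr_klP_natCast]
  simp only [qFac_klP]
  push_cast
  ring_nf

/-- Cast of `vwpClosedR` to `ℂ`. [folklore] -/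
theorem vwpClosedR_cast (g δ n ε : ℕ) :
    (vwpClosedR k g δ n ε : ℂ) = qFac (klP k) (g + δ + 1 + (n + ε)) * qFac (klP k) g * qFac (klP k) (n + ε + g + 1) *
      qFac (klP k) ε / (qFac (klP k) n * qFac (klP k) (ε + g + 1) * qFac (klP k) (δ + n)) := by
  unfold vwpClosedR
  push_cast
  simp only [qFac_klP]

/-- **The factorial-form VWP sum at `p = e^{iπ/(k+2)}`** (real form), valid as long as all factorial arguments
stay `≤ k + 1`. [cite: GasperRahman2004, §2.4 eq. (2.4.2), §7.2] -/
theorem vwp_sumR {g δ n ε : ℕ} (h : g + δ + 1 + (n + ε) + n ≤ k + 1) :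
    ∑ y ∈ range (n + 1), vwpTermR k g δ n ε y = vwpClosedR k g δ n ε := by
  apply Complex.ofReal_injective
  push_cast
  simp only [vwpTermR_cast, vwpClosedR_cast]
  exact vwp_factorial_sum (klP_ne_zero k) fun m h1 h2 => qBr_klP_ne_zero k (by exact_mod_cast h1) (by omega)

/-! ### The extremal column `j₀ = a - b` -/

/-- The column `j₀ = a - b` of the Racah matrix is a single term:
`S_{i,a-b} = (-1)^Z [Z+1]! / ([(d+i-a)/2]! [(b+i-c)/2]! [(a+d-b-c)/2]! [(b+c-i)/2]! [(a+c-b-d)/2]!)`, `Z = (a+i+d)/2`.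
[cite: KauffmanLins1994, §9.11] -/
theorem racahSum_col_single {a b c d i : ℕ} (hba : b ≤ a) (hadi : Adm k a d i) (hbci : Adm k b c i)
    (hcdj : Adm k c d (a - b)) :
    racahSum k a b (a - b) c d i =
      (-1 : ℝ) ^ ((a + i + d) / 2) * qFactorial k ((a + i + d) / 2 + 1) /
        (qFactorial k ((d + i - a) / 2) * qFactorial k ((b + i - c) / 2) * qFactorial k ((a + d - (b + c)) / 2) *
          qFactorial k ((b + c - i) / 2) * qFactorial k ((a + c - (b + d)) / 2)) := by
  unfold Adm at hadi hbci hcdj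
  obtain ⟨pa, ta1, ta2, ta3, la⟩ := hadi
  obtain ⟨pb, tb1, tb2, tb3, lb⟩ := hbci
  obtain ⟨pd, td1, td2, td3, ld⟩ := hcdj
  unfold racahSum
  simp only
  have hle : max (max ((a + b + (a - b)) / 2) ((a - b + c + d) / 2)) (max ((b + c + i) / 2) ((a + i + d) / 2)) ≤
      min (min ((a + b + c + d) / 2) ((a + (a - b) + c + i) / 2)) ((b + (a - b) + d + i) / 2) := by
    refine le_min (le_min ?_ ?_) ?_ <;> refine max_le (max_le ?_ ?_) (max_le ?_ ?_) <;> omega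
  have hZ : (b + (a - b) + d + i) / 2 = (a + i + d) / 2 := by clear hle; omega
  have htop : min (min ((a + b + c + d) / 2) ((a + (a - b) + c + i) / 2)) ((b + (a - b) + d + i) / 2) =
      (a + i + d) / 2 :=
    le_antisymm ((min_le_right _ _).trans hZ.le) (((le_max_right _ _).trans (le_max_right _ _)).trans hle)
  have hbot : max (max ((a + b + (a - b)) / 2) ((a - b + c + d) / 2)) (max ((b + c + i) / 2) ((a + i + d) / 2)) =
      (a + i + d) / 2 :=
    le_antisymm (hle.trans htop.le) ((le_max_right _ _).trans (le_max_right _ _))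
  rw [htop, hbot, Icc_self, sum_singleton]
  clear hle htop hbot hZ
  rw [show (a + i + d) / 2 - (a + b + (a - b)) / 2 = (d + i - a) / 2 by omega,
    show (a + i + d) / 2 - (a - b + c + d) / 2 = (b + i - c) / 2 by omega,
    show (a + i + d) / 2 - (b + c + i) / 2 = (a + d - (b + c)) / 2 by omega,
    show (a + i + d) / 2 - (a + i + d) / 2 = 0 by omega,
    show (a + b + c + d) / 2 - (a + i + d) / 2 = (b + c - i) / 2 by omega,
    show (a + (a - b) + c + i) / 2 - (a + i + d) / 2 = (a + c - (b + d)) / 2 by omega,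
    show (b + (a - b) + d + i) / 2 - (a + i + d) / 2 = 0 by omega, qFactorial_zero, mul_one, mul_one]

/-! ### The two dictionaries `ṽ_i S_{ij₀}² = vwpTermR / ([B']!²[A']!²)` -/

/-- Case `c + d ≤ a + b` (`i_min = a - d`): with `i = a - d + 2y`,
`ṽ_i S_{i,a-b}² = vwpTermR(A', P₂', N, B'; y)/([B']!²[A']!²)` where `A' = (a+c-b-d)/2`, `P₂' = (a+b-c-d)/2`,
`N = (b+c+d-a)/2`, `B' = (a+d-b-c)/2`. [cite: GasperRahman2004, §7.2 (7.2.15)–(7.2.16)] -/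
theorem racah_normTerm_eq₁ {a b c d y : ℕ} (hba : b ≤ a) (hc1 : c ≤ d + (a - b)) (hc2 : d ≤ c + (a - b))
    (hP : c + d ≤ a + b) (hpar : (a + b + c + d) % 2 = 0) (hy : y ≤ (b + c + d - a) / 2)
    (hadi : Adm k a d (a - d + 2 * y)) (hbci : Adm k b c (a - d + 2 * y)) (hcdj : Adm k c d (a - b)) :
    racahV k a d c b (a - d + 2 * y) * racahSum k a b (a - b) c d (a - d + 2 * y) * racahSum k a b (a - b) c d (a - d + 2 * y) =
      vwpTermR k ((a + c - (b + d)) / 2) ((a + b - (c + d)) / 2) ((b + c + d - a) / 2) ((a + d - (b + c)) / 2) y /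
        (qFactorial k ((a + d - (b + c)) / 2) ^ 2 * qFactorial k ((a + c - (b + d)) / 2) ^ 2) := by
  rw [racahSum_col_single k hba hadi hbci hcdj]
  unfold Adm at hadi hbci hcdj
  obtain ⟨pa, ta1, ta2, ta3, la⟩ := hadi
  obtain ⟨pb, tb1, tb2, tb3, lb⟩ := hbci
  obtain ⟨pd, td1, td2, td3, ld⟩ := hcdj
  -- the sign squares away
  have hs : (-1 : ℝ) ^ ((a + (a - d + 2 * y) + d) / 2) * (-1) ^ ((a + (a - d + 2 * y) + d) / 2) = 1 := by
    rw [← pow_add, ← two_mul, pow_mul]; simp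
  rw [show ∀ V x A D : ℝ, V * (x * A / D) * (x * A / D) = V * ((x * x) * (A * A) / (D * D)) from
    fun V x A D => by ring, hs, one_mul]
  unfold racahV vwpTermR
  have hda : d ≤ a := by omega
  generalize hg : (a + c - (b + d)) / 2 = g
  generalize hδ : (a + b - (c + d)) / 2 = δ
  generalize hn : (b + c + d - a) / 2 = n at hy ⊢
  generalize hε : (a + d - (b + c)) / 2 = ε
  have hg2 : 2 * g + (b + d) = a + c := by omega
  have hδ2 : 2 * δ + (c + d) = a + b := by omega
  have hn2 : 2 * n + a = b + c + d := by omega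
  have hε2 : 2 * ε + (b + c) = a + d := by omega
  clear hg hδ hn hε
  -- the row written additively
  obtain ⟨i, hi⟩ : ∃ i, i = a - d + 2 * y := ⟨_, rfl⟩
  have hi2 : i + d = a + 2 * y := by omega
  rw [← hi] at *
  clear hi
  -- the index dictionary
  have e1 : (d + i - a) / 2 = y := by omega
  have e2 : (b + i - c) / 2 = y + δ := by clear e1; omega
  have e3 : (c + i - b) / 2 = y + g := by clear e1 e2; omega
  have e4 : (a + i - d) / 2 = y + (g + δ) := by clear e1 e2 e3; omega
  have e5 : (c + b - i) / 2 = n - y := by clear e1 e2 e3 e4; omega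
  have e6 : (a + d - i) / 2 = n + ε - y := by clear e1 e2 e3 e4 e5; omega
  have e7 : (a + d + i) / 2 + 1 = y + (g + δ + 1 + (n + ε)) := by clear e1 e2 e3 e4 e5 e6; omega
  have e8 : (c + b + i) / 2 + 1 = y + (g + δ) + 1 + n := by clear e1 e2 e3 e4 e5 e6 e7; omega
  have e9 : (a + i + d) / 2 + 1 = y + (g + δ + 1 + (n + ε)) := by clear e1 e2 e3 e4 e5 e6 e7 e8; omega
  have e10 : (b + c - i) / 2 = n - y := by clear e1 e2 e3 e4 e5 e6 e7 e8 e9; omega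
  have e11 : i + 1 = 2 * y + (g + δ) + 1 := by clear e1 e2 e3 e4 e5 e6 e7 e8 e9 e10; omega
  rw [e1, e2, e3, e4, e5, e6, e7, e8, e9, e10, e11]
  clear e1 e2 e3 e4 e5 e6 e7 e8 e9 e10 e11
  -- non-vanishing of the denominators, then clear them
  have h1 : qFactorial k (y + (g + δ + 1 + (n + ε))) ≠ 0 := (qFactorial_pos k (by omega)).ne'
  have h2 : qFactorial k (y + (g + δ) + 1 + n) ≠ 0 := (qFactorial_pos k (by omega)).ne'
  have h3 : qFactorial k y ≠ 0 := (qFactorial_pos k (by omega)).ne'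
  have h4 : qFactorial k (y + δ) ≠ 0 := (qFactorial_pos k (by omega)).ne'
  have h5 : qFactorial k ε ≠ 0 := (qFactorial_pos k (by omega)).ne'
  have h6 : qFactorial k (n - y) ≠ 0 := (qFactorial_pos k (by omega)).ne'
  have h7 : qFactorial k g ≠ 0 := (qFactorial_pos k (by omega)).ne'
  generalize qFactorial k (y + (g + δ + 1 + (n + ε))) = F1 at *
  generalize qFactorial k (y + (g + δ) + 1 + n) = F2 at *
  generalize qFactorial k y = F3 at *
  generalize qFactorial k (y + δ) = F4 at *
  generalize qFactorial k ε = F5 at *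
  generalize qFactorial k (n - y) = F6 at *
  generalize qFactorial k g = F7 at *
  generalize qFactorial k (y + g) = F8
  generalize qFactorial k (y + (g + δ)) = F9
  generalize qFactorial k (n + ε - y) = F10
  generalize qInt k (2 * y + (g + δ) + 1) = Q1
  field_simp

/-- Case `a + b < c + d` (`i_min = c - b`): with `i = c - b + 2y`,
`ṽ_i S_{i,a-b}² = vwpTermR(A', x₀, b, B'; y)/([B']!²[A']!²)` where `A' = (a+c-b-d)/2`, `x₀ = (c+d-a-b)/2`,
`B' = (a+d-b-c)/2`. [cite: GasperRahman2004, §7.2 (7.2.15)–(7.2.16)] -/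
theorem racah_normTerm_eq₂ {a b c d y : ℕ} (hba : b ≤ a) (hc1 : c ≤ d + (a - b)) (hc2 : d ≤ c + (a - b))
    (hP : a + b < c + d) (hpar : (a + b + c + d) % 2 = 0) (hy : y ≤ b)
    (hadi : Adm k a d (c - b + 2 * y)) (hbci : Adm k b c (c - b + 2 * y)) (hcdj : Adm k c d (a - b)) :
    racahV k a d c b (c - b + 2 * y) * racahSum k a b (a - b) c d (c - b + 2 * y) * racahSum k a b (a - b) c d (c - b + 2 * y) =
      vwpTermR k ((a + c - (b + d)) / 2) ((c + d - (a + b)) / 2) b ((a + d - (b + c)) / 2) y /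
        (qFactorial k ((a + d - (b + c)) / 2) ^ 2 * qFactorial k ((a + c - (b + d)) / 2) ^ 2) := by
  rw [racahSum_col_single k hba hadi hbci hcdj]
  unfold Adm at hadi hbci hcdj
  obtain ⟨pa, ta1, ta2, ta3, la⟩ := hadi
  obtain ⟨pb, tb1, tb2, tb3, lb⟩ := hbci
  obtain ⟨pd, td1, td2, td3, ld⟩ := hcdj
  -- the sign squares away
  have hs : (-1 : ℝ) ^ ((a + (c - b + 2 * y) + d) / 2) * (-1) ^ ((a + (c - b + 2 * y) + d) / 2) = 1 := by
    rw [← pow_add, ← two_mul, pow_mul]; simp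
  rw [show ∀ V x A D : ℝ, V * (x * A / D) * (x * A / D) = V * ((x * x) * (A * A) / (D * D)) from
    fun V x A D => by ring, hs, one_mul]
  unfold racahV vwpTermR
  have hcb : b ≤ c := by omega
  generalize hg : (a + c - (b + d)) / 2 = g
  generalize hδ : (c + d - (a + b)) / 2 = δ
  generalize hε : (a + d - (b + c)) / 2 = ε
  have hg2 : 2 * g + (b + d) = a + c := by omega
  have hδ2 : 2 * δ + (a + b) = c + d := by omega
  have hε2 : 2 * ε + (b + c) = a + d := by omega
  clear hg hδ hε
  -- the row written additively
  obtain ⟨i, hi⟩ : ∃ i, i = c - b + 2 * y := ⟨_, rfl⟩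
  have hi2 : i + b = c + 2 * y := by omega
  rw [← hi] at *
  clear hi
  -- the index dictionary
  have e1 : (d + i - a) / 2 = y + δ := by omega
  have e2 : (b + i - c) / 2 = y := by clear e1; omega
  have e3 : (c + i - b) / 2 = y + (g + δ) := by clear e1 e2; omega
  have e4 : (a + i - d) / 2 = y + g := by clear e1 e2 e3; omega
  have e5 : (c + b - i) / 2 = b - y := by clear e1 e2 e3 e4; omega
  have e6 : (a + d - i) / 2 = b + ε - y := by clear e1 e2 e3 e4 e5; omega
  have e7 : (a + d + i) / 2 + 1 = y + (g + δ + 1 + (b + ε)) := by clear e1 e2 e3 e4 e5 e6; omega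
  have e8 : (c + b + i) / 2 + 1 = y + (g + δ) + 1 + b := by clear e1 e2 e3 e4 e5 e6 e7; omega
  have e9 : (a + i + d) / 2 + 1 = y + (g + δ + 1 + (b + ε)) := by clear e1 e2 e3 e4 e5 e6 e7 e8; omega
  have e10 : (b + c - i) / 2 = b - y := by clear e1 e2 e3 e4 e5 e6 e7 e8 e9; omega
  have e11 : i + 1 = 2 * y + (g + δ) + 1 := by clear e1 e2 e3 e4 e5 e6 e7 e8 e9 e10; omega
  rw [e1, e2, e3, e4, e5, e6, e7, e8, e9, e10, e11]
  clear e1 e2 e3 e4 e5 e6 e7 e8 e9 e10 e11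
  -- non-vanishing of the denominators, then clear them
  have h1 : qFactorial k (y + (g + δ + 1 + (b + ε))) ≠ 0 := (qFactorial_pos k (by omega)).ne'
  have h2 : qFactorial k (y + (g + δ) + 1 + b) ≠ 0 := (qFactorial_pos k (by omega)).ne'
  have h3 : qFactorial k y ≠ 0 := (qFactorial_pos k (by omega)).ne'
  have h4 : qFactorial k (y + δ) ≠ 0 := (qFactorial_pos k (by omega)).ne'
  have h5 : qFactorial k ε ≠ 0 := (qFactorial_pos k (by omega)).ne'
  have h6 : qFactorial k (b - y) ≠ 0 := (qFactorial_pos k (by omega)).ne'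
  have h7 : qFactorial k g ≠ 0 := (qFactorial_pos k (by omega)).ne'
  generalize qFactorial k (y + (g + δ + 1 + (b + ε))) = F1 at *
  generalize qFactorial k (y + (g + δ) + 1 + b) = F2 at *
  generalize qFactorial k y = F3 at *
  generalize qFactorial k (y + δ) = F4 at *
  generalize qFactorial k ε = F5 at *
  generalize qFactorial k (b - y) = F6 at *
  generalize qFactorial k g = F7 at *
  generalize qFactorial k (y + g) = F8
  generalize qFactorial k (y + (g + δ)) = F9
  generalize qFactorial k (b + ε - y) = F10
  generalize qInt k (2 * y + (g + δ) + 1) = Q1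
  field_simp

/-! ### The rows as an arithmetic progression, the weight of the column `j₀`, and the norm -/

/-- Case `c + d ≤ a + b`: the rows are `i = a - d + 2y`, `0 ≤ y ≤ N = (b+c+d-a)/2`. [folklore] -/
theorem rowSet_eq_image₁ {a b c d : ℕ} (hba : b ≤ a) (hc1 : c ≤ d + (a - b)) (hc2 : d ≤ c + (a - b))
    (hj : a ≤ b + c + d) (hP : c + d ≤ a + b) (hpar : (a + b + c + d) % 2 = 0) (hsmall : a + b + c + d ≤ 2 * k) :
    rowSet k a b c d = (range ((b + c + d - a) / 2 + 1)).image fun y => a - d + 2 * y := by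
  ext i
  rw [mem_rowSet, mem_image]
  unfold Adm
  constructor
  · rintro ⟨hik, ⟨pa, ta1, ta2, ta3, la⟩, ⟨pb, tb1, tb2, tb3, lb⟩⟩
    refine ⟨(i + d - a) / 2, mem_range.mpr ?_, ?_⟩ <;> omega
  · rintro ⟨y, hy, rfl⟩
    rw [mem_range] at hy
    refine ⟨by omega, ⟨by omega, by omega, by omega, by omega, by omega⟩, ⟨?_, by omega, by omega, by omega, by omega⟩⟩
    omega

/-- Case `a + b < c + d`: the rows are `i = c - b + 2y`, `0 ≤ y ≤ b`. [folklore] -/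
theorem rowSet_eq_image₂ {a b c d : ℕ} (hba : b ≤ a) (hc1 : c ≤ d + (a - b)) (hc2 : d ≤ c + (a - b))
    (hP : a + b < c + d) (hpar : (a + b + c + d) % 2 = 0) (hsmall : a + b + c + d ≤ 2 * k) :
    rowSet k a b c d = (range (b + 1)).image fun y => c - b + 2 * y := by
  ext i
  rw [mem_rowSet, mem_image]
  unfold Adm
  constructor
  · rintro ⟨hik, ⟨pa, ta1, ta2, ta3, la⟩, ⟨pb, tb1, tb2, tb3, lb⟩⟩
    refine ⟨(i + b - c) / 2, mem_range.mpr ?_, ?_⟩ <;> omega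
  · rintro ⟨y, hy, rfl⟩
    rw [mem_range] at hy
    refine ⟨by omega, ⟨by omega, by omega, by omega, by omega, by omega⟩, ⟨?_, by omega, by omega, by omega, by omega⟩⟩
    omega

/-- The weight of the extremal column: `v_{a-b} = [a-b+1]·[B']![A']![a-b]![N]![b]!/([a+1]![Q'+1]!)` with
`B' = (a+d-b-c)/2`, `A' = (a+c-b-d)/2`, `N = (b+c+d-a)/2`, `Q' = (a+c+d-b)/2`. [folklore] -/
theorem racahV_col {a b c d : ℕ} (hba : b ≤ a) (hc1 : c ≤ d + (a - b)) (hc2 : d ≤ c + (a - b))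
    (hpar : (a + b + c + d) % 2 = 0) :
    racahV k a b c d (a - b) =
      qInt k (a - b + 1) * (qFactorial k ((a + d - (b + c)) / 2) * qFactorial k ((a + c - (b + d)) / 2) *
        qFactorial k (a - b) * qFactorial k ((b + c + d - a) / 2) * qFactorial k b) /
        (qFactorial k (a + 1) * qFactorial k ((a + c + d - b) / 2 + 1)) := by
  unfold racahV
  rw [show (b + (a - b) - a) / 2 = 0 by omega, show (d + (a - b) - c) / 2 = (a + d - (b + c)) / 2 by omega,
    show (c + (a - b) - d) / 2 = (a + c - (b + d)) / 2 by omega, show (a + (a - b) - b) / 2 = a - b by omega,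
    show (c + d - (a - b)) / 2 = (b + c + d - a) / 2 by omega, show (a + b - (a - b)) / 2 = b by omega,
    show (a + b + (a - b)) / 2 + 1 = a + 1 by omega, show (c + d + (a - b)) / 2 + 1 = (a + c + d - b) / 2 + 1 by omega,
    qFactorial_zero, one_mul]

/-- From a dictionary to the norm: if the rows are `i₀ + 2y` (`y ≤ n`), each `ṽ_i S_{ij₀}²` is `vwpTermR(y)/E`, the
factorial arguments stay `≤ k+1`, and the closed form matches `E/v_{j₀}`, then `Σ_i ṽ_i S_{ij₀}² = v_{j₀}⁻¹`. [folklore] -/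
theorem norm_of_dictionary {a b c d i₀ g δ n ε : ℕ} {E : ℝ}
    (himg : rowSet k a b c d = (range (n + 1)).image fun y => i₀ + 2 * y)
    (hterm : ∀ y, y ≤ n → racahV k a d c b (i₀ + 2 * y) * racahSum k a b (a - b) c d (i₀ + 2 * y) *
      racahSum k a b (a - b) c d (i₀ + 2 * y) = vwpTermR k g δ n ε y / E)
    (hbound : g + δ + 1 + (n + ε) + n ≤ k + 1) (hclosed : vwpClosedR k g δ n ε / E = (racahV k a b c d (a - b))⁻¹) :
    ∑ i ∈ rowSet k a b c d, racahV k a d c b i * racahSum k a b (a - b) c d i * racahSum k a b (a - b) c d i =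
      (racahV k a b c d (a - b))⁻¹ := by
  rw [himg, sum_image fun y₁ _ y₂ _ h => by omega]
  rw [sum_congr rfl fun y hy => hterm y (Nat.lt_succ_iff.mp (mem_range.mp hy)), ← sum_div, vwp_sumR k hbound,
    hclosed]

/-- **The norm of the extremal column** (normalised small configurations): for `b ≤ a`, `|c - d| ≤ a - b`,
`a + b + c + d ≤ 2k` of even sum, `Σ_{i ∈ I} ṽ_i S_{i,a-b}² = 1/v_{a-b}`.
[cite: KauffmanLins1994, §9.11–9.12] [cite: GasperRahman2004, §7.2 eq. (7.2.15)–(7.2.16)] -/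
theorem racahSum_norm_small {a b c d : ℕ} (ha : a ≤ k) (hba : b ≤ a) (hc1 : c ≤ d + (a - b)) (hc2 : d ≤ c + (a - b))
    (hj : a ≤ b + c + d) (hpar : (a + b + c + d) % 2 = 0) (hsmall : a + b + c + d ≤ 2 * k) :
    ∑ i ∈ rowSet k a b c d, racahV k a d c b i * racahSum k a b (a - b) c d i * racahSum k a b (a - b) c d i =
      (racahV k a b c d (a - b))⁻¹ := by
  have hE : qFactorial k ((a + d - (b + c)) / 2) ^ 2 * qFactorial k ((a + c - (b + d)) / 2) ^ 2 ≠ 0 :=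
    mul_ne_zero (pow_ne_zero _ (qFactorial_pos k (by omega)).ne') (pow_ne_zero _ (qFactorial_pos k (by omega)).ne')
  have hcdj : Adm k c d (a - b) := by unfold Adm; omega
  rcases le_or_gt (c + d) (a + b) with hP | hP
  · -- case `i_min = a - d`
    have himg := rowSet_eq_image₁ k hba hc1 hc2 hj hP hpar hsmall
    refine norm_of_dictionary k (g := (a + c - (b + d)) / 2) (δ := (a + b - (c + d)) / 2) (n := (b + c + d - a) / 2)
      (ε := (a + d - (b + c)) / 2)
      (E := qFactorial k ((a + d - (b + c)) / 2) ^ 2 * qFactorial k ((a + c - (b + d)) / 2) ^ 2)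
      himg (fun y hy => ?_) (by omega) ?_
    · have hmem : a - d + 2 * y ∈ rowSet k a b c d := by
        rw [himg]; exact mem_image_of_mem _ (mem_range.mpr (by omega))
      rw [mem_rowSet] at hmem
      exact racah_normTerm_eq₁ k hba hc1 hc2 hP hpar hy hmem.2.1 hmem.2.2 hcdj
    · rw [racahV_col k hba hc1 hc2 hpar]
      unfold vwpClosedR
      generalize hg : (a + c - (b + d)) / 2 = g at *
      generalize hδ : (a + b - (c + d)) / 2 = δ at *
      generalize hn : (b + c + d - a) / 2 = n at *
      generalize hε : (a + d - (b + c)) / 2 = ε at *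
      have e1 : g + δ + 1 + (n + ε) = a + 1 := by omega
      have e2 : n + ε + g + 1 = (a + c + d - b) / 2 + 1 := by omega
      have e3 : ε + g + 1 = (a - b) + 1 := by omega
      have e4 : δ + n = b := by omega
      rw [e1, e2, e3, e4, qFactorial_succ k (a - b)]
      have h1 : qFactorial k (a + 1) ≠ 0 := (qFactorial_pos k (by omega)).ne'
      have h2 : qFactorial k ((a + c + d - b) / 2 + 1) ≠ 0 := (qFactorial_pos k (by omega)).ne'
      have h3 : qFactorial k (a - b) ≠ 0 := (qFactorial_pos k (by omega)).ne'
      have h4 : qInt k (a - b + 1) ≠ 0 := qInt_ne_zero k (by omega) (by omega)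
      have h5 : qFactorial k n ≠ 0 := (qFactorial_pos k (by omega)).ne'
      have h6 : qFactorial k b ≠ 0 := (qFactorial_pos k (by omega)).ne'
      have h7 : qFactorial k ε ≠ 0 := (qFactorial_pos k (by omega)).ne'
      have h8 : qFactorial k g ≠ 0 := (qFactorial_pos k (by omega)).ne'
      generalize qFactorial k (a + 1) = F1 at *
      generalize qFactorial k ((a + c + d - b) / 2 + 1) = F2 at *
      generalize qFactorial k (a - b) = F3 at *
      generalize qInt k (a - b + 1) = Q1 at *
      generalize qFactorial k n = F5 at *
      generalize qFactorial k b = F6 at *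
      generalize qFactorial k ε = F7 at *
      generalize qFactorial k g = F8 at *
      field_simp
  · -- case `i_min = c - b`
    have himg := rowSet_eq_image₂ k hba hc1 hc2 hP hpar hsmall
    refine norm_of_dictionary k (g := (a + c - (b + d)) / 2) (δ := (c + d - (a + b)) / 2) (n := b)
      (ε := (a + d - (b + c)) / 2)
      (E := qFactorial k ((a + d - (b + c)) / 2) ^ 2 * qFactorial k ((a + c - (b + d)) / 2) ^ 2)
      himg (fun y hy => ?_) (by omega) ?_
    · have hmem : c - b + 2 * y ∈ rowSet k a b c d := by
        rw [himg]; exact mem_image_of_mem _ (mem_range.mpr (by omega))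
      rw [mem_rowSet] at hmem
      exact racah_normTerm_eq₂ k hba hc1 hc2 hP hpar hy hmem.2.1 hmem.2.2 hcdj
    · rw [racahV_col k hba hc1 hc2 hpar]
      unfold vwpClosedR
      generalize hg : (a + c - (b + d)) / 2 = g at *
      generalize hδ : (c + d - (a + b)) / 2 = δ at *
      generalize hn : (b + c + d - a) / 2 = n at *
      generalize hε : (a + d - (b + c)) / 2 = ε at *
      have e1 : g + δ + 1 + (b + ε) = (a + c + d - b) / 2 + 1 := by omega
      have e2 : b + ε + g + 1 = a + 1 := by omega
      have e3 : ε + g + 1 = (a - b) + 1 := by omega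
      have e4 : δ + b = n := by omega
      rw [e1, e2, e3, e4, qFactorial_succ k (a - b)]
      have h1 : qFactorial k (a + 1) ≠ 0 := (qFactorial_pos k (by omega)).ne'
      have h2 : qFactorial k ((a + c + d - b) / 2 + 1) ≠ 0 := (qFactorial_pos k (by omega)).ne'
      have h3 : qFactorial k (a - b) ≠ 0 := (qFactorial_pos k (by omega)).ne'
      have h4 : qInt k (a - b + 1) ≠ 0 := qInt_ne_zero k (by omega) (by omega)
      have h5 : qFactorial k n ≠ 0 := (qFactorial_pos k (by omega)).ne'
      have h6 : qFactorial k b ≠ 0 := (qFactorial_pos k (by omega)).ne'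
      have h7 : qFactorial k ε ≠ 0 := (qFactorial_pos k (by omega)).ne'
      have h8 : qFactorial k g ≠ 0 := (qFactorial_pos k (by omega)).ne'
      generalize qFactorial k (a + 1) = F1 at *
      generalize qFactorial k ((a + c + d - b) / 2 + 1) = F2 at *
      generalize qFactorial k (a - b) = F3 at *
      generalize qInt k (a - b + 1) = Q1 at *
      generalize qFactorial k n = F5 at *
      generalize qFactorial k b = F6 at *
      generalize qFactorial k ε = F7 at *
      generalize qFactorial k g = F8 at *
      field_simp

end Literature.RepresentationTheory.ModularTensorCategories.SU2LevelK
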